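import Mathlib.Analysis.Fourier.AddCircleMulti
import Mathlib.MeasureTheory.Integral.Prod
import Mathlib.MeasureTheory.Function.L2Space
import Mathlib.MeasureTheory.Function.AEEqOfIntegral
import Mathlib.Analysis.InnerProductSpace.Subspace
import Literature.Analysis.FunctionSpaces.FlatTorus
import HarnessLib

/-!
# Riesz–Fischer on `T^d` with a measurable parameter

Grafakos 2014, Prop. 3.2.7 (4) (PDF p. 196): the map `f ↦ (f̂(m))_{m ∈ ℤⁿ}` is an isometry of
`L²(Tⁿ)` *onto* `ℓ²(ℤⁿ)` (Riesz–Fischer), the characters `e_m(x) = e^{2πi m·x}` being a complete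
orthonormal system (`∫ e_m conj(e_k) = δ_{mk}`, PDF p. 195). This file proves the version with a
measurable parameter that the fluid files need in order to produce **jointly measurable**
representatives of spectrally defined fields (weak gradients of `L²_t H¹_x` velocities, cf.
`Torus.IsLerayHopfOn.exists_hasWeakGradient` in `Literature/Analysis/FluidPDE/DissipationAnomaly`):

* `Torus.exists_memLp_two_forall_mFourierCoeff_eq` — given a finite measure `μ` on a parameter
  space `α` and coefficients `c : α → ℤ^d → ℂ`, measurable in the parameter for each frequency,
  with `∫ ∑_k ‖c(t, k)‖² dμ(t) < ∞`, there is `g : α → T^d → ℂ`, **jointly** a.e.-strongly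
  measurable for `μ ⊗ dx`, such that for `μ`-a.e. `t` the slice `g t` lies in `L²(T^d)` and has
  Fourier coefficients `𝓕(g t)(k) = c(t, k)` for all `k`.

Proof: the elementary tensors `(t, x) ↦ c(t, k) e_k(x)` are pairwise orthogonal in the Hilbert
space `L²(μ ⊗ dx)` with `∑_k ‖·‖² = ∫ ∑_k ‖c(t,k)‖² < ∞`, hence summable
(`OrthogonalFamily.summable_iff_norm_sq_summable`); the sum `g` is an `L²(μ ⊗ dx)` class, so any
representative is jointly measurable, its slices are in `L²` for a.e. `t` (Tonelli), and testing
`g` against `1_A ⊗ e_k` for measurable `A ⊆ α` gives `∫_A 𝓕(g t)(k) dμ = ∫_A c(t, k) dμ`, whence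
`𝓕(g t)(k) = c(t, k)` a.e. (`Integrable.ae_eq_of_forall_setIntegral_eq`), simultaneously for the
countably many `k`.

Auxiliary (H21's global `volume` on `T^d`, transported from Mathlib's local Haar volume by
`Torus.volume_eq_pi_haarAddCircle`): `Torus.norm_mFourier_apply` (`|e_n(x)| = 1`),
`Torus.mFourierCoeff_mFourier` (`𝓕(e_l)(k) = δ_{kl}`, from Mathlib's `HilbertBasis.repr_self` for
`UnitAddTorus.mFourierBasis`), `Torus.mFourierCoeff_eq_integral_conj_mul`
(`𝓕g(k) = ∫ conj(e_k) g` for the global volume), `Torus.integral_conj_mFourier_mul_mFourier`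
(orthonormality), and the `L²` bookkeeping lemmas `Torus.memLp_two_of_lintegral_enorm_sq`,
`Torus.lintegral_enorm_sq_lt_top_of_memLp`, `Torus.memLp_mul_mFourier`,
`Torus.inner_toLp_mul_mFourier`.

## Mathlib search

Mathlib has Riesz–Fischer on `UnitAddTorus d` in the form of the Hilbert basis
`UnitAddTorus.mFourierBasis : HilbertBasis (d → ℤ) ℂ (Lp ℂ 2 volume)` (local Haar volume) and
Parseval `UnitAddTorus.hasSum_sq_mFourierCoeff`; it has no parametrised/jointly-measurable version
(searched `mFourierBasis`, `Riesz`, `hasSum_mFourier`: nothing with a product measure).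

## References

* L. Grafakos, *Classical Fourier Analysis*, 3rd ed., GTM 249 (Springer 2014), Prop. 3.2.7 (1),
  (3), (4), PDF pp. 195–196; orthonormality of the characters, PDF p. 195. [Grafakos2014]
-/

open MeasureTheory Set Filter Topology UnitAddTorus Function
open scoped ENNReal NNReal ComplexConjugate InnerProductSpace

noncomputable section

namespace Literature.Analysis.FunctionSpaces

namespace Torus

variable {d : Type*} [Fintype d]

/-! ## Characters in the global volume -/

/-- The characters have modulus one: `|e_n(x)| = 1` (Grafakos 2014, §3.1). [folklore] -/
theorem norm_mFourier_apply (n : d → ℤ) (x : UnitAddTorus d) : ‖mFourier n x‖ = 1 := by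
  simp [mFourier]

/-- `‖e_n(x)‖ₑ = 1` in `ℝ≥0∞`. [folklore] -/
theorem enorm_mFourier_apply (n : d → ℤ) (x : UnitAddTorus d) : ‖mFourier n x‖ₑ = 1 := by
  rw [← ofReal_norm, norm_mFourier_apply, ENNReal.ofReal_one]

/-- **Fourier coefficients of the characters**: `𝓕(e_l)(k) = δ_{kl}` (Grafakos 2014, PDF p. 195,
orthonormality of `{e_m}`; here from Mathlib's `HilbertBasis.repr_self` for
`UnitAddTorus.mFourierBasis` and `UnitAddTorus.mFourierBasis_repr`). [cite: Grafakos2014, Prop. 3.2.7] -/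
theorem mFourierCoeff_mFourier [DecidableEq (d → ℤ)] (k l : d → ℤ) :
    mFourierCoeff (⇑(mFourier l) : UnitAddTorus d → ℂ) k = if k = l then 1 else 0 := by
  have h1 : mFourierCoeff (⇑(mFourier l) : UnitAddTorus d → ℂ) k =
      mFourierCoeff (mFourierLp (d := d) 2 l : UnitAddTorus d → ℂ) k :=
    (mFourierCoeff_toLp (mFourier l) k).symm
  rw [h1, ← mFourierBasis_repr, ← coe_mFourierBasis, HilbertBasis.repr_self, lp.single_apply,
    Pi.single_apply]

/-- Fourier coefficients for H21's global `volume`, scalar form: `𝓕g(k) = ∫ conj(e_k(x)) g(x) dx`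
(Mathlib's `mFourierCoeff` integrates `e_{-k} • g` against the local Haar volume, equal to the
global one by `Torus.volume_eq_pi_haarAddCircle`; `e_{-k} = conj e_k`, `UnitAddTorus.mFourier_neg`)
(Grafakos 2014, (3.1.4)). [folklore] -/
theorem mFourierCoeff_eq_integral_conj_mul (g : UnitAddTorus d → ℂ) (k : d → ℤ) :
    mFourierCoeff g k = ∫ x, conj (mFourier k x) * g x := by
  have h : mFourierCoeff g k = ∫ x, mFourier (-k) x • g x :=
    congrArg (fun μ : Measure (UnitAddTorus d) => ∫ x, mFourier (-k) x • g x ∂μ)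
      (volume_eq_pi_haarAddCircle (d := d)).symm
  rw [h]
  simp_rw [mFourier_neg, smul_eq_mul]

/-- **Orthonormality of the characters** in the global volume:
`∫ conj(e_k) e_l = δ_{kl}` (Grafakos 2014, PDF p. 195). [cite: Grafakos2014, Prop. 3.2.7] -/
theorem integral_conj_mFourier_mul_mFourier [DecidableEq (d → ℤ)] (k l : d → ℤ) :
    ∫ x : UnitAddTorus d, conj (mFourier k x) * mFourier l x = if k = l then 1 else 0 := by
  rw [← mFourierCoeff_eq_integral_conj_mul, mFourierCoeff_mFourier]

/-! ## `L²` bookkeeping -/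

/-- `f ∈ L²` from a.e.-strong measurability and `∫⁻ ‖f‖ₑ² < ∞` (unfolding `eLpNorm` at `p = 2`,
Mathlib `eLpNorm_lt_top_iff_lintegral_rpow_enorm_lt_top`). [folklore] -/
theorem memLp_two_of_lintegral_enorm_sq {α : Type*} [MeasurableSpace α] {μ : Measure α}
    {E : Type*} [NormedAddCommGroup E] {f : α → E} (hf : AEStronglyMeasurable f μ)
    (h : ∫⁻ x, ‖f x‖ₑ ^ 2 ∂μ ≠ ∞) : MemLp f 2 μ := by
  refine ⟨hf, ?_⟩
  rw [eLpNorm_lt_top_iff_lintegral_rpow_enorm_lt_top two_ne_zero ENNReal.ofNat_ne_top]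
  simpa [ENNReal.toReal_ofNat] using h.lt_top

/-- `∫⁻ ‖f‖ₑ² < ∞` for `f ∈ L²` (converse bookkeeping of `memLp_two_of_lintegral_enorm_sq`). [folklore] -/
theorem lintegral_enorm_sq_lt_top_of_memLp {α : Type*} [MeasurableSpace α] {μ : Measure α}
    {E : Type*} [NormedAddCommGroup E] {f : α → E} (hf : MemLp f 2 μ) :
    ∫⁻ x, ‖f x‖ₑ ^ 2 ∂μ < ∞ := by
  have h := hf.2
  rw [eLpNorm_lt_top_iff_lintegral_rpow_enorm_lt_top two_ne_zero ENNReal.ofNat_ne_top] at h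
  simpa [ENNReal.toReal_ofNat] using h

section Param

variable {α : Type*} [MeasurableSpace α] {μ : Measure α}

/-- The elementary tensors `(t, x) ↦ c(t) e_k(x)` lie in `L²(μ ⊗ dx)` when `∫ ‖c‖² dμ < ∞`
(`|e_k| = 1` and Tonelli, `MeasureTheory.lintegral_prod`). [folklore] -/
theorem memLp_mul_mFourier [SFinite μ] {c : α → ℂ} (hc : AEStronglyMeasurable c μ)
    (h : ∫⁻ t, ‖c t‖ₑ ^ 2 ∂μ ≠ ∞) (k : d → ℤ) :
    MemLp (fun z : α × UnitAddTorus d => c z.1 * mFourier k z.2) 2 (μ.prod volume) := by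
  have hm : AEStronglyMeasurable (fun z : α × UnitAddTorus d => c z.1 * mFourier k z.2)
      (μ.prod volume) :=
    hc.comp_fst.mul (mFourier k).continuous.aestronglyMeasurable.comp_snd
  refine memLp_two_of_lintegral_enorm_sq hm ?_
  have heq : ∀ z : α × UnitAddTorus d, ‖c z.1 * mFourier k z.2‖ₑ ^ 2 = ‖c z.1‖ₑ ^ 2 := by
    intro z
    rw [enorm_mul, enorm_mFourier_apply, mul_one]
  simp_rw [heq]
  rw [lintegral_prod _ (hc.comp_fst.enorm.pow_const 2)]
  simpa [lintegral_const] using h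

/-- **Orthogonality of the elementary tensors**: in `L²(μ ⊗ dx)`,
`⟪c ⊗ e_k, c' ⊗ e_l⟫ = δ_{kl} ∫ conj(c) c' dμ` (Fubini, `MeasureTheory.integral_prod`, and the
orthonormality of the characters `integral_conj_mFourier_mul_mFourier`; Grafakos 2014, PDF
p. 195). [cite: Grafakos2014, Prop. 3.2.7] -/
theorem inner_toLp_mul_mFourier [SFinite μ] [DecidableEq (d → ℤ)] {c c' : α → ℂ}
    (hc : AEStronglyMeasurable c μ) (h : ∫⁻ t, ‖c t‖ₑ ^ 2 ∂μ ≠ ∞)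
    (hc' : AEStronglyMeasurable c' μ) (h' : ∫⁻ t, ‖c' t‖ₑ ^ 2 ∂μ ≠ ∞) (k l : d → ℤ) :
    ⟪(memLp_mul_mFourier hc h k).toLp _, (memLp_mul_mFourier hc' h' l).toLp _⟫_ℂ =
      if k = l then ∫ t, conj (c t) * c' t ∂μ else 0 := by
  have hae : (fun z : α × UnitAddTorus d =>
      ⟪((memLp_mul_mFourier hc h k).toLp _ : α × UnitAddTorus d → ℂ) z,
        ((memLp_mul_mFourier hc' h' l).toLp _ : α × UnitAddTorus d → ℂ) z⟫_ℂ) =ᵐ[μ.prod volume]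
      fun z => conj (c z.1 * mFourier k z.2) * (c' z.1 * mFourier l z.2) := by
    filter_upwards [(memLp_mul_mFourier hc h k).coeFn_toLp,
      (memLp_mul_mFourier hc' h' l).coeFn_toLp] with z hz hz'
    rw [hz, hz', RCLike.inner_apply, mul_comm]
  have hint : Integrable (fun z : α × UnitAddTorus d =>
      conj (c z.1 * mFourier k z.2) * (c' z.1 * mFourier l z.2)) (μ.prod volume) :=
    (L2.integrable_inner (𝕜 := ℂ) ((memLp_mul_mFourier hc h k).toLp _)
      ((memLp_mul_mFourier hc' h' l).toLp _)).congr hae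
  rw [L2.inner_def, integral_congr_ae hae, integral_prod _ hint]
  have hinner : ∀ t : α, ∫ x : UnitAddTorus d, conj (c t * mFourier k x) * (c' t * mFourier l x) =
      conj (c t) * c' t * (if k = l then 1 else 0) := by
    intro t
    rw [← integral_conj_mFourier_mul_mFourier, ← integral_const_mul]
    refine integral_congr_ae (ae_of_all _ fun x => ?_)
    simp only [map_mul]
    ring
  simp_rw [hinner]
  split_ifs with hkl
  · simp
  · simp

/-- Testing a jointly integrable `G` against `1_A ⊗ e_k`: `∫ conj(1_A(t) e_k(x)) G(t, x) =
∫_{t ∈ A} 𝓕(G(t, ·))(k) dμ` (Fubini, `MeasureTheory.integral_prod`, and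
`mFourierCoeff_eq_integral_conj_mul`). [folklore] -/
theorem integral_conj_indicator_mul_mFourier_mul [SFinite μ] {A : Set α} (hA : MeasurableSet A)
    (k : d → ℤ) {G : α × UnitAddTorus d → ℂ}
    (hG : Integrable (fun z => conj (A.indicator (fun _ => (1 : ℂ)) z.1 * mFourier k z.2) * G z)
      (μ.prod volume)) :
    ∫ z, conj (A.indicator (fun _ => (1 : ℂ)) z.1 * mFourier k z.2) * G z ∂(μ.prod volume) =
      ∫ t in A, mFourierCoeff (fun x => G (t, x)) k ∂μ := by
  rw [integral_prod _ hG, ← integral_indicator hA]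
  refine integral_congr_ae (ae_of_all _ fun t => ?_)
  by_cases ht : t ∈ A
  · simp only [ht, indicator_of_mem, one_mul, mFourierCoeff_eq_integral_conj_mul]
  · simp [ht]

/-- **Riesz–Fischer on `T^d` with a measurable parameter** (Grafakos 2014, Prop. 3.2.7 (4), PDF
p. 196, uniformly in a parameter). Let `μ` be a finite measure on `α` and `c : α → ℤ^d → ℂ` with
`t ↦ c(t, k)` a.e.-strongly measurable for every `k` and `∫ ∑_k ‖c(t, k)‖² dμ(t) < ∞`. Then there
is `g : α → T^d → ℂ`, jointly a.e.-strongly measurable for `μ ⊗ dx`, such that for `μ`-a.e. `t`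
the slice `g t` is in `L²(T^d)` with `𝓕(g t)(k) = c(t, k)` for all `k ∈ ℤ^d`. Proof: the tensors
`c(·, k) ⊗ e_k` form a summable orthogonal family in `L²(μ ⊗ dx)`
(`OrthogonalFamily.summable_iff_norm_sq_summable`, `inner_toLp_mul_mFourier`); the sum has `L²`
slices a.e. (Tonelli) whose coefficients are identified by testing against `1_A ⊗ e_k`
(`integral_conj_indicator_mul_mFourier_mul`, `Integrable.ae_eq_of_forall_setIntegral_eq`). [cite: Grafakos2014, Prop. 3.2.7 (4)] -/
theorem exists_memLp_two_forall_mFourierCoeff_eq [IsFiniteMeasure μ]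
    {c : α → (d → ℤ) → ℂ} (hc : ∀ k, AEStronglyMeasurable (fun t => c t k) μ)
    (hC : ∫⁻ t, ∑' k, ‖c t k‖ₑ ^ 2 ∂μ ≠ ∞) :
    ∃ g : α → UnitAddTorus d → ℂ, AEStronglyMeasurable (uncurry g) (μ.prod volume) ∧
      ∀ᵐ t ∂μ, MemLp (g t) 2 volume ∧ ∀ k, mFourierCoeff (g t) k = c t k := by
  classical
  -- each coefficient is square integrable in the parameter
  have hck : ∀ k, ∫⁻ t, ‖c t k‖ₑ ^ 2 ∂μ ≠ ∞ := fun k =>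
    ne_top_of_le_ne_top hC (lintegral_mono fun t => ENNReal.le_tsum k)
  -- the elementary tensors `c(t, k) e_k(x)` as elements of `L²(μ ⊗ dx)`
  set X : (d → ℤ) → Lp ℂ 2 (μ.prod (volume : Measure (UnitAddTorus d))) :=
    fun k => (memLp_mul_mFourier (hc k) (hck k) k).toLp _ with hX
  have hinner : ∀ k l, ⟪X k, X l⟫_ℂ = if k = l then ∫ t, conj (c t k) * c t l ∂μ else 0 :=
    fun k l => inner_toLp_mul_mFourier (hc k) (hck k) (hc l) (hck l) k l
  -- norms
  have hnorm : ∀ k, ‖X k‖ ^ 2 = (∫⁻ t, ‖c t k‖ₑ ^ 2 ∂μ).toReal := by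
    intro k
    have h1 : ((‖X k‖ ^ 2 : ℝ) : ℂ) = ∫ t, conj (c t k) * c t k ∂μ := by
      rw [← hinner k k |>.trans (if_pos rfl), inner_self_eq_norm_sq_to_K]
      norm_cast
    have h2 : ∫ t, conj (c t k) * c t k ∂μ = ((∫ t, ‖c t k‖ ^ 2 ∂μ : ℝ) : ℂ) := by
      rw [← integral_complex_ofReal]
      refine integral_congr_ae (ae_of_all _ fun t => ?_)
      dsimp only
      rw [RCLike.conj_mul]
      norm_cast
    have h3 : ‖X k‖ ^ 2 = ∫ t, ‖c t k‖ ^ 2 ∂μ := by exact_mod_cast h1.trans h2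
    rw [h3, integral_eq_lintegral_of_nonneg_ae (ae_of_all _ fun t => sq_nonneg _)
      ((hc k).norm.pow 2)]
    congr 1
    refine lintegral_congr fun t => ?_
    rw [← ofReal_norm, ENNReal.ofReal_pow (norm_nonneg _)]
  -- summability of the orthogonal family
  have hV : OrthogonalFamily ℂ (fun k => ↥(ℂ ∙ X k)) fun k => (ℂ ∙ X k).subtypeₗᵢ := by
    intro k l hkl v w
    obtain ⟨a, ha⟩ := Submodule.mem_span_singleton.1 v.2
    obtain ⟨b, hb⟩ := Submodule.mem_span_singleton.1 w.2
    simp only [Submodule.coe_subtypeₗᵢ, Submodule.coe_subtype, ← ha, ← hb, inner_smul_left,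
      inner_smul_right, hinner, if_neg hkl, mul_zero]
  have hsq : Summable fun k => ‖X k‖ ^ 2 := by
    simp_rw [hnorm]
    refine ENNReal.summable_toReal ?_
    rwa [← lintegral_tsum fun k => ((hc k).enorm.pow_const 2)]
  have hsum : Summable X := by
    have h := (hV.summable_iff_norm_sq_summable
      (fun k => (⟨X k, Submodule.mem_span_singleton_self _⟩ : ↥(ℂ ∙ X k)))).2
      (by simpa using hsq)
    simpa using h
  set g : Lp ℂ 2 (μ.prod (volume : Measure (UnitAddTorus d))) := ∑' k, X k with hg_def
  have hg : HasSum X g := hsum.hasSum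
  have hgi : Integrable (g : α × UnitAddTorus d → ℂ) (μ.prod volume) :=
    (Lp.memLp g).integrable one_le_two
  -- slice coefficients: test against `1_A ⊗ e_k`
  have hcoef : ∀ k, (fun t => mFourierCoeff (fun x => g (t, x)) k) =ᵐ[μ] fun t => c t k := by
    intro k
    have hFk : Integrable (fun z : α × UnitAddTorus d => conj (mFourier k z.2) * g z)
        (μ.prod volume) := by
      refine hgi.bdd_mul (c := 1) ?_ (ae_of_all _ fun z => ?_)
      · exact (Complex.continuous_conj.comp_aestronglyMeasurable
          (mFourier k).continuous.aestronglyMeasurable.comp_snd)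
      · rw [RCLike.norm_conj, norm_mFourier_apply]
    have hI1 : Integrable (fun t => mFourierCoeff (fun x => g (t, x)) k) μ := by
      refine hFk.integral_prod_left.congr (ae_of_all _ fun t => ?_)
      simp only [mFourierCoeff_eq_integral_conj_mul]
    have hI2 : Integrable (fun t => c t k) μ :=
      (memLp_two_of_lintegral_enorm_sq (hc k) (hck k)).integrable one_le_two
    refine Integrable.ae_eq_of_forall_setIntegral_eq _ _ hI1 hI2 fun A hA _ => ?_
    -- the test element `1_A ⊗ e_k`
    have hind : AEStronglyMeasurable (A.indicator fun _ => (1 : ℂ)) μ :=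
      aestronglyMeasurable_const.indicator hA
    have hindL : ∫⁻ t, ‖A.indicator (fun _ => (1 : ℂ)) t‖ₑ ^ 2 ∂μ ≠ ∞ := by
      refine ne_top_of_le_ne_top (measure_ne_top μ univ) ?_
      calc ∫⁻ t, ‖A.indicator (fun _ => (1 : ℂ)) t‖ₑ ^ 2 ∂μ ≤ ∫⁻ _t, 1 ∂μ := by
            refine lintegral_mono fun t => ?_
            by_cases ht : t ∈ A <;> simp [ht]
        _ = μ univ := by rw [lintegral_const, one_mul]
    set y : Lp ℂ 2 (μ.prod (volume : Measure (UnitAddTorus d))) :=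
      (memLp_mul_mFourier hind hindL k).toLp _ with hy
    have hyae : (y : α × UnitAddTorus d → ℂ) =ᵐ[μ.prod volume]
        fun z => A.indicator (fun _ => (1 : ℂ)) z.1 * mFourier k z.2 :=
      (memLp_mul_mFourier hind hindL k).coeFn_toLp
    -- `⟪y, g⟫ = ∫_A c(t, k) dμ`
    have hyX : ∀ l, ⟪y, X l⟫_ℂ = if l = k then ∫ t in A, c t k ∂μ else 0 := by
      intro l
      rw [hy, hX, inner_toLp_mul_mFourier hind hindL (hc l) (hck l) k l]
      by_cases hlk : l = k
      · subst hlk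
        rw [if_pos rfl, if_pos rfl, ← integral_indicator hA]
        refine integral_congr_ae (ae_of_all _ fun t => ?_)
        by_cases ht : t ∈ A <;> simp [ht]
      · rw [if_neg (Ne.symm hlk), if_neg hlk]
    have h1 : ⟪y, g⟫_ℂ = ∫ t in A, c t k ∂μ := by
      have hs : HasSum (fun l => ⟪y, X l⟫_ℂ) ⟪y, g⟫_ℂ := by
        simpa only [innerSL_apply_apply] using hg.mapL (innerSL ℂ y)
      simp_rw [hyX] at hs
      exact hs.unique (hasSum_ite_eq k _)
    -- `⟪y, g⟫ = ∫_A 𝓕(g(t, ·))(k) dμ`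
    have h2 : ⟪y, g⟫_ℂ = ∫ t in A, mFourierCoeff (fun x => g (t, x)) k ∂μ := by
      have hae : (fun z : α × UnitAddTorus d => ⟪(y : α × UnitAddTorus d → ℂ) z,
          (g : α × UnitAddTorus d → ℂ) z⟫_ℂ) =ᵐ[μ.prod volume]
          fun z => conj (A.indicator (fun _ => (1 : ℂ)) z.1 * mFourier k z.2) * g z := by
        filter_upwards [hyae] with z hz
        rw [RCLike.inner_apply, mul_comm, hz]
      rw [← integral_conj_indicator_mul_mFourier_mul hA k ((L2.integrable_inner y g).congr hae),
        L2.inner_def, integral_congr_ae hae]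
    rw [← h2, h1]
  -- slices are in `L²` (Tonelli)
  have hg2 : ∀ᵐ t ∂μ, ∫⁻ x, ‖g (t, x)‖ₑ ^ 2 < ∞ := by
    have h := lintegral_enorm_sq_lt_top_of_memLp (Lp.memLp g)
    rw [lintegral_prod _ ((Lp.aestronglyMeasurable g).enorm.pow_const 2)] at h
    exact ae_lt_top' ((Lp.aestronglyMeasurable g).enorm.pow_const 2).lintegral_prod_right' h.ne
  refine ⟨fun t x => g (t, x), Lp.aestronglyMeasurable g, ?_⟩
  filter_upwards [hg2, (Lp.aestronglyMeasurable g).prodMk_left, ae_all_iff.2 hcoef]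
    with t ht hm hc
  exact ⟨memLp_two_of_lintegral_enorm_sq hm ht.ne, hc⟩

end Param

end Torus

end Literature.Analysis.FunctionSpaces
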